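import Summits.ResolutionOfSingularities.ResolutionOfSingularities.Theorems.TameQuotientLU2
import Literature.AlgebraicGeometry.Resolution.TameAbelianToricDescent
import Literature.AlgebraicGeometry.Resolution.TameAbelianEigenparameters
import Literature.AlgebraicGeometry.Resolution.TameCyclicFixedModel
import Literature.AlgebraicGeometry.Resolution.CyclicInvariantsFiniteType
import Literature.AlgebraicGeometry.Resolution.TameCyclicToricDescent
import Literature.AlgebraicGeometry.Resolution.ExcellentRingsFieldProofs
import Literature.AlgebraicGeometry.Resolution.AffineModelLU
import HarnessLib

/-!
# TameAbelianQuotientLU — the tame ABELIAN quotient law for relative local uniformization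

ROOT/RESIDUAL decomposition cell `decomp-res`, lens 1 («grading / quantitative ladder»),
generation 26, window (W-ab) of critic row 193.  Problem side, sorry-free, hypothesis-free.

## The law (kernel, hypothesis-free)

`relLU_of_tameAbelianEquivariantLUAbove : TameAbelianEquivariantLUAbove k O → RelLocalUniformization k K O`.

For EVERY finite ABELIAN tame Galois top `K′/K` (`G = Gal(K′/K)` abelian of exponent dividing
`ℓ` with `ℓ ∈ k×` and `μ_ℓ ⊆ k`) carrying a `G`-stable valuation ring `O′` above `O` with
residues in `k` (so `G = G_Z` and `G` is residually trivial) such that every finitely generated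
birational model `R ⊆ O` of `K` has a `G`-STABLE model `R[t₀] ⊆ O′` of `K′` above it whose local
ring at the centre of `O′` is regular — the place `O` of `K/k` admits relative local
uniformization.  The INHERITANCE POINT of the window («joint eigen-coordinates for commuting
tame automorphisms») is PROVED in the kernel, not assumed: the model brick
`exists_jointly_fixed_model_isRegularLocalRing` descends a `G`-stable regular model through the
WHOLE abelian group at once — joint eigen-parameters of the commuting family
(`exists_joint_eigen_regularParameters_of_commuting`, [CoP1] Prop. 6.2 (2) (28)–(30)), the ring
of joint invariants as the local ring of the jointly fixed model (iterated
`locAtCentre_inf_fixedSubring_eq` + Noether finiteness `fg_fixedSubalgebra_of_cyclic`, one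
generator at a time — legitimate because the generators COMMUTE, so each fixed subalgebra is
stable under the next generator), and the jointly fixed toric chart
(`exists_fixed_toricChart_of_commuting_isRegularLocalRing`, [CoP1] Lemma 9.4 / Fulton §2.6).
The cyclic law of generation 25 (tree: `TameQuotientLU.relLU_of_tameEquivariantLUAbove`) is the
case `G` cyclic: `tameAbelianEquivariantLUAbove_of_tameEquivariantLUAbove :
TameQuotientLU.TameEquivariantLUAbove k O → TameAbelianEquivariantLUAbove k O` (BY NAME, proved);
a non-cyclic abelian `G` (e.g. `(ℤ/ℓ)²` acting diagonally on a bicyclic Kummer top) is NOT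
reachable from it by iterating cyclic steps, because the cyclic model brick returns a `σ`-fixed
model that need not be stable under the remaining generators (open point (α) of row 193).
Honest scope: ON PAPER the abelian cell is even contained in the cyclic one — pass to a
co-cyclic subgroup `H ≤ G` and the cyclic top `K′^H / K`, whose `G/H`-stable regular models come
from the ARGUMENT of this file's brick (joint `G`-eigen-parameters, `H`-invariant monomials) — so `R25 ↔ R26`
below is an equality of regions on paper as it is an equivalence in the kernel; what the law adds
is the uniformization below a NON-CYCLIC abelian top `G = G_Z` directly from its `G`-stable
models, with the inheritance point proved (in the kernel the containment is NOT cheap: it IS the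
brick).

## The residual and the exact cuts (hypothesis-free, by name against the tree)

* `NonKHToricArchLUKeyHenselDescentAbel e c n` (R26) := the binders of R23
  (`GaloisDescentLU.NonKHToricArchLUKeyHenselDescent`) + ONE more, `¬ TameAbelianEquivariantLUAbove k O`
  — i.e. R25 (`TameQuotientLU.NonKHToricArchLUKeyHenselDescentQuot`) with its last binder
  `¬ TameQuotientLU.TameEquivariantLUAbove k O` REPLACED by the weaker requirement off the larger cell.
* `nonKHToricArchLUKeyHenselDescentQuot_iff_abel : R25 ↔ R26` — THE CUT of the window, exact, through
  the one binder `¬ TameAbelianEquivariantLUAbove ⇒ ¬ TameEquivariantLUAbove` and the law (no D, no H);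
  `nonKHToricArchLUKeyHenselDescent_iff_abel : R23 ↔ R26`; both at `(3, 3, 4)`.
* `closes_abel` — the summit `_root_.ResolutionOfSingularities` BY NAME from the threefold
  inputs of `GaloisDescentLU.closes_descent` with R23 replaced by R26; `root_iff_abel_sigma`.
* Part D (single-column hygiene, 0-weight): `NonKHToricArchLUKeyHenselDescentEigenAbel` (R26E) = R23 +
  `¬ EigenLadderLU.TameEigenChartBelow k O` + `¬ TameAbelianEquivariantLUAbove k O`;
  `nonKHToricArchLUKeyHenselDescentEigen_iff_eigenAbel : R24⁺ ↔ R26E` HYPOTHESIS-FREE,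
  `nonKHToricArchLUKeyHenselDescentAbel_iff_eigenAbel : TheoremDAll → (R26 ↔ R26E)`, `closes_eigenAbel`.

## Sources

* V. Cossart, O. Piltant, J. Algebra 320 (2008) 1051–1082, Prop. 6.2 (2) and proof of
  Lemma 9.4 (HAL hal-00139124 pp. 19, 28–29). [CossartPiltant2008]
* V. Cossart, O. Piltant, J. Algebra 529 (2019) 268–535, §4.1 (LU), Prop. 4.10.
  [CossartPiltant2019]
* W. Fulton, *Introduction to toric varieties* (1993), §2.6. [Fulton1993Toric]
* F.-V. Kuhlmann, *Valuation theoretic and model theoretic aspects of local uniformization*,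
  in: Resolution of Singularities (Obergurgl 1997), Progr. Math. 181 (2000), §§13–15
  (Galois/ramification-theoretic descent of local uniformization through the inertia group of a
  tame extension). [Kuhlmann2000]
-/

noncomputable section

open IntermediateField Polynomial Literature.AlgebraicGeometry.Resolution IsLocalRing

namespace Summit.ResolutionOfSingularities.ResolutionOfSingularities.Theorems.TameAbelianQuotientLU

/-! ## Part A1 — the jointly fixed model of a commuting tame family (abelian analogue of
`TameCyclicFixedModel` + `CyclicInvariantsFiniteType`; Literature-shaped, see WRITER.md) -/

section JointFixed

variable {F : Type} [Field F]

/-- The subring of elements fixed by ONE automorphism `σ`. -/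
def fixedBy (σ : F ≃+* F) : Subring F :=
  { carrier := {x | σ x = x}
    mul_mem' := fun {a b} ha hb => by
      change σ (a * b) = a * b; rw [map_mul, (ha : σ a = a), (hb : σ b = b)]
    one_mem' := map_one σ
    add_mem' := fun {a b} ha hb => by
      change σ (a + b) = a + b; rw [map_add, (ha : σ a = a), (hb : σ b = b)]
    zero_mem' := map_zero σ
    neg_mem' := fun {a} ha => by change σ (-a) = -a; rw [map_neg, (ha : σ a = a)] }

/-- `mem_fixedBy`: Auxiliary step of this node's calculus, VERBATIM from the lens file (see the module docstring);
the statement is its type. [folklore] -/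
theorem mem_fixedBy (σ : F ≃+* F) (x : F) : x ∈ fixedBy σ ↔ σ x = x := Iff.rfl

/-- The subring of JOINT invariants of the family `τ 0, …, τ (r-1)` (`F^G` for the group `G`
they generate). (Sources: CossartPiltant2008, Prop. 6.2 (2) (HAL p. 19).) -/
def jointFixedSubring (τ : ℕ → F ≃+* F) (r : ℕ) : Subring F :=
  { carrier := {x | ∀ i < r, τ i x = x}
    mul_mem' := fun {a b} ha hb =>
      show ∀ i < r, τ i (a * b) = a * b from fun i hi => by
        rw [map_mul, (ha : ∀ i < r, τ i a = a) i hi, (hb : ∀ i < r, τ i b = b) i hi]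
    one_mem' := show ∀ i < r, τ i 1 = 1 from fun i _ => map_one (τ i)
    add_mem' := fun {a b} ha hb =>
      show ∀ i < r, τ i (a + b) = a + b from fun i hi => by
        rw [map_add, (ha : ∀ i < r, τ i a = a) i hi, (hb : ∀ i < r, τ i b = b) i hi]
    zero_mem' := show ∀ i < r, τ i 0 = 0 from fun i _ => map_zero (τ i)
    neg_mem' := fun {a} ha =>
      show ∀ i < r, τ i (-a) = -a from fun i hi => by
        rw [map_neg, (ha : ∀ i < r, τ i a = a) i hi] }

/-- `mem_jointFixedSubring`: Auxiliary step of this node's calculus, VERBATIM from the lens file (see the module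
docstring); the statement is its type. [folklore] -/
theorem mem_jointFixedSubring (τ : ℕ → F ≃+* F) (r : ℕ) (x : F) :
    x ∈ jointFixedSubring τ r ↔ ∀ i < r, τ i x = x := Iff.rfl

/-- `jointFixedSubring_zero`: Auxiliary step of this node's calculus, VERBATIM from the lens file (see the module
docstring); the statement is its type. [folklore] -/
theorem jointFixedSubring_zero (τ : ℕ → F ≃+* F) : jointFixedSubring τ 0 = ⊤ := by
  ext x
  exact ⟨fun _ => Subring.mem_top x,
    fun _ => (mem_jointFixedSubring τ 0 x).mpr fun i hi => absurd hi (Nat.not_lt_zero i)⟩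

/-- `jointFixedSubring_succ`: Auxiliary step of this node's calculus, VERBATIM from the lens file (see the module
docstring); the statement is its type. [folklore] -/
theorem jointFixedSubring_succ (τ : ℕ → F ≃+* F) (m : ℕ) :
    jointFixedSubring τ (m + 1) = jointFixedSubring τ m ⊓ fixedBy (τ m) := by
  ext x
  rw [Subring.mem_inf, mem_jointFixedSubring, mem_jointFixedSubring, mem_fixedBy]
  constructor
  · intro h; exact ⟨fun i hi => h i (Nat.lt_succ_of_lt hi), h m (Nat.lt_succ_self m)⟩
  · rintro ⟨h1, h2⟩ i hi
    rcases Nat.lt_succ_iff_lt_or_eq.mp hi with hi | rfl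
    · exact h1 i hi
    · exact h2

/-- **The ring of joint invariants of the local ring of a stable model is the local ring of the
jointly fixed model**: `(T_𝔪)^G = (T^G)_𝔪` for a COMMUTING family of tame automorphisms
(`τᵢ^ℓ = 1`) preserving `O` and `T` — one commuting generator at a time
(`TameCyclicFixedModel.locAtCentre_inf_fixedSubring_eq`; each partial ring of invariants is
stable under the next generator because the generators commute). (Sources: CossartPiltant2008, proof of Lemma 9.4 (HAL p. 29), "`R₁ := S₁^G` is a local model".) -/
theorem locAtCentre_inf_jointFixedSubring_eq (τ : ℕ → F ≃+* F) (r : ℕ) {ℓ : ℕ} (hℓ0 : ℓ ≠ 0)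
    (hτℓ : ∀ i < r, τ i ^ ℓ = 1)
    (hcomm : ∀ i < r, ∀ i' < r, ∀ z : F, τ i (τ i' z) = τ i' (τ i z))
    (O : ValuationSubring F) (hO : ∀ i < r, ∀ x ∈ O, τ i x ∈ O)
    (T : Subring F) (hT : ∀ i < r, ∀ x ∈ T, τ i x ∈ T) :
    locAtCentre T O ⊓ jointFixedSubring τ r = locAtCentre (T ⊓ jointFixedSubring τ r) O := by
  suffices h : ∀ m ≤ r, locAtCentre T O ⊓ jointFixedSubring τ m =
      locAtCentre (T ⊓ jointFixedSubring τ m) O from h r le_rfl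
  intro m
  induction m with
  | zero => intro; rw [jointFixedSubring_zero, inf_top_eq, inf_top_eq]
  | succ m ih =>
    intro hm
    have hm' : m < r := Nat.lt_of_succ_le hm
    have hstab : ∀ x ∈ T ⊓ jointFixedSubring τ m, τ m x ∈ T ⊓ jointFixedSubring τ m := by
      intro x hx
      rw [Subring.mem_inf, mem_jointFixedSubring] at hx ⊢
      refine ⟨hT m hm' x hx.1, fun i hi => ?_⟩
      rw [hcomm i (hi.trans hm') m hm', hx.2 i hi]
    calc locAtCentre T O ⊓ jointFixedSubring τ (m + 1)
        = (locAtCentre T O ⊓ jointFixedSubring τ m) ⊓ fixedBy (τ m) := by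
          rw [jointFixedSubring_succ, inf_assoc]
      _ = locAtCentre (T ⊓ jointFixedSubring τ m) O ⊓ fixedBy (τ m) := by rw [ih hm'.le]
      _ = locAtCentre ((T ⊓ jointFixedSubring τ m) ⊓ fixedBy (τ m)) O :=
          locAtCentre_inf_fixedSubring_eq (τ m) hℓ0 (hτℓ m hm') O (hO m hm') _ hstab
            (fixedBy (τ m)) (mem_fixedBy (τ m))
      _ = locAtCentre (T ⊓ jointFixedSubring τ (m + 1)) O := by
          rw [jointFixedSubring_succ, inf_assoc]

/-- **Noether finiteness for the jointly fixed model** ([CoP1] proof of Lemma 9.4: "`R₁ := S₁^G`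
… is a normal local MODEL"): for `S ⊆ F` Noetherian fixed by a COMMUTING family of
automorphisms `τ 0, …, τ (r-1)` of finite order dividing `ℓ`, and a finitely generated model
`S[t₀]` STABLE under every `τ i`, the jointly fixed subring `S[t₀]^G` is a finitely generated
model `S[G₁]`, `G₁ ⊆ S[t₀]` jointly fixed — Noether's theorem for one cyclic generator at a time
(`CyclicInvariantsFiniteType.fg_fixedSubalgebra_of_cyclic`), each partial algebra of invariants
being stable under the next generator because the generators commute. (Sources: CossartPiltant2008, proof of Lemma
9.4 (HAL p. 29); AtiyahMacdonald1969, Ch. 7 Ex. 5.) -/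
theorem exists_finset_closure_eq_inf_jointFixedSubring (τ : ℕ → F ≃+* F) (r : ℕ) {ℓ : ℕ}
    (hℓ0 : ℓ ≠ 0) (hτℓ : ∀ i < r, τ i ^ ℓ = 1)
    (hcomm : ∀ i < r, ∀ i' < r, ∀ z : F, τ i (τ i' z) = τ i' (τ i z))
    (S : Subring F) (hS : IsNoetherianRing S) (hτS : ∀ i < r, ∀ s ∈ S, τ i s = s)
    (t₀ : Finset F) (hτT₀ : ∀ i < r, ∀ x ∈ Subring.closure ((S : Set F) ∪ ↑t₀),
      τ i x ∈ Subring.closure ((S : Set F) ∪ ↑t₀)) :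
    ∃ G₁ : Finset F, (∀ i < r, ∀ z ∈ G₁, τ i z = z) ∧
      (∀ z ∈ G₁, z ∈ Subring.closure ((S : Set F) ∪ ↑t₀)) ∧
      Subring.closure ((S : Set F) ∪ ↑t₀) ⊓ jointFixedSubring τ r =
        Subring.closure ((S : Set F) ∪ ↑G₁) := by
  classical
  set T₀ := Subring.closure ((S : Set F) ∪ ↑t₀) with hT₀
  have hST₀ : S ≤ T₀ := fun s hs => Subring.subset_closure (Or.inl hs)
  have hℓpos : 0 < ℓ := Nat.pos_of_ne_zero hℓ0
  haveI := hS
  -- `(τ i)⁻¹ = (τ i)^(ℓ-1)`; powers preserve `T₀` and commute with the other generators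
  have hτsymm : ∀ i < r, ∀ b : F, (τ i).symm b = (τ i ^ (ℓ - 1)) b := fun i hi b => by
    rw [RingEquiv.symm_apply_eq]
    change b = (τ i * τ i ^ (ℓ - 1)) b
    rw [← pow_succ', Nat.sub_add_cancel hℓpos, hτℓ i hi]
    rfl
  have hτpowT₀ : ∀ i < r, ∀ (k : ℕ) (b : F), b ∈ T₀ → (τ i ^ k) b ∈ T₀ := by
    intro i hi k
    induction k with
    | zero => intro b hb; exact hb
    | succ k ih => intro b hb; rw [pow_succ', RingAut.mul_apply]; exact hτT₀ i hi _ (ih b hb)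
  have hτT₀' : ∀ i < r, ∀ x ∈ T₀, (τ i).symm x ∈ T₀ := fun i hi x hx => by
    rw [hτsymm i hi]; exact hτpowT₀ i hi _ x hx
  have hcommpow : ∀ i < r, ∀ i' < r, ∀ (k : ℕ) (z : F),
      τ i ((τ i' ^ k) z) = (τ i' ^ k) (τ i z) := by
    intro i hi i' hi' k
    induction k with
    | zero => intro z; rfl
    | succ k ih =>
      intro z
      rw [pow_succ', RingAut.mul_apply, RingAut.mul_apply, hcomm i hi i' hi', ih]
  -- `T₀` is a finitely generated `S`-algebra
  letI algST₀ : Algebra S T₀ := (Subring.inclusion hST₀).toAlgebra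
  haveI : Algebra.FiniteType S T₀ := by
    let f : Algebra.adjoin S (t₀ : Set F) →ₐ[S] T₀ :=
      { toFun := fun x => ⟨(x : F), by
          have h : (x : F) ∈ (Algebra.adjoin S (t₀ : Set F)).toSubring := x.2
          rw [Algebra.adjoin_eq_ring_closure] at h
          refine (Subring.closure_le.mpr ?_ : _ ≤ T₀) h
          rintro z (⟨w, rfl⟩ | hz)
          · exact hST₀ w.2
          · exact Subring.subset_closure (Or.inr hz)⟩
        map_one' := rfl
        map_mul' := fun _ _ => rfl
        map_zero' := rfl
        map_add' := fun _ _ => rfl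
        commutes' := fun _ => rfl }
    have hf : Function.Surjective f := by
      rintro ⟨z, hz⟩
      have hz' : z ∈ (Algebra.adjoin S (t₀ : Set F)).toSubring := by
        rw [Algebra.adjoin_eq_ring_closure]
        refine (Subring.closure_le.mpr ?_ : T₀ ≤ _) hz
        rintro w (hw | hw)
        · exact Subring.subset_closure (Or.inl ⟨⟨w, hw⟩, rfl⟩)
        · exact Subring.subset_closure (Or.inr hw)
      exact ⟨⟨z, hz'⟩, rfl⟩
    haveI : Algebra.FiniteType S (Algebra.adjoin S (t₀ : Set F)) :=
      (Subalgebra.fg_iff_finiteType _).mp (Subalgebra.fg_adjoin_finset _)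
    exact Algebra.FiniteType.of_surjective f hf
  -- the subalgebras `AT m` of elements fixed by `τ 0, …, τ (m-1)` are finitely generated
  let AT : ℕ → Subalgebra S T₀ := fun m =>
    { carrier := {c | ∀ i < m, i < r → τ i (c : F) = c}
      mul_mem' := fun {a b} ha hb =>
        show ∀ i < m, i < r → τ i ((a : F) * b) = (a : F) * b from fun i hi hir => by
          rw [map_mul, (ha : ∀ i < m, i < r → τ i (a : F) = a) i hi hir,
            (hb : ∀ i < m, i < r → τ i (b : F) = b) i hi hir]
      one_mem' := show ∀ i < m, i < r → τ i (1 : F) = 1 from fun i _ _ => map_one (τ i)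
      add_mem' := fun {a b} ha hb =>
        show ∀ i < m, i < r → τ i ((a : F) + b) = (a : F) + b from fun i hi hir => by
          rw [map_add, (ha : ∀ i < m, i < r → τ i (a : F) = a) i hi hir,
            (hb : ∀ i < m, i < r → τ i (b : F) = b) i hi hir]
      zero_mem' := show ∀ i < m, i < r → τ i (0 : F) = 0 from fun i _ _ => map_zero (τ i)
      algebraMap_mem' := fun s => show ∀ i < m, i < r → τ i ((s : S) : F) = s from
        fun i _ hir => hτS i hir _ s.2 }
  have hAT : ∀ m ≤ r, ∀ (c : T₀), c ∈ AT m ↔ ∀ i < m, τ i (c : F) = c := fun m hm c =>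
    ⟨fun h i hi => h i hi (lt_of_lt_of_le hi hm), fun h i hi _ => h i hi⟩
  have hATfg : ∀ m ≤ r, (AT m).FG := by
    intro m
    induction m with
    | zero =>
      intro
      have h0 : AT 0 = ⊤ := by
        ext c
        exact ⟨fun _ => Algebra.mem_top,
          fun _ => (hAT 0 (Nat.zero_le r) c).mpr fun i hi => absurd hi (Nat.not_lt_zero i)⟩
      rw [h0]
      exact Algebra.FiniteType.out
    | succ m ih =>
      intro hm
      have hm' : m < r := Nat.lt_of_succ_le hm
      obtain ⟨g, hg⟩ := ih hm'.le
      haveI : Algebra.FiniteType S (AT m) := (Subalgebra.fg_iff_finiteType _).mp ⟨g, hg⟩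
      -- `τ m` induces an `S`-algebra automorphism of `AT m` (the generators commute)
      have hstab : ∀ c : T₀, c ∈ AT m → (⟨τ m c, hτT₀ m hm' c c.2⟩ : T₀) ∈ AT m := by
        intro c hc
        rw [hAT m hm'.le] at hc ⊢
        intro i hi
        change τ i (τ m (c : F)) = τ m c
        rw [hcomm i (hi.trans hm') m hm', hc i hi]
      have hstab' : ∀ c : T₀, c ∈ AT m → (⟨(τ m).symm c, hτT₀' m hm' c c.2⟩ : T₀) ∈ AT m := by
        intro c hc
        rw [hAT m hm'.le] at hc ⊢
        intro i hi
        change τ i ((τ m).symm (c : F)) = (τ m).symm c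
        rw [hτsymm m hm', hcommpow i (hi.trans hm') m hm', hc i hi]
      let σC : (AT m) ≃ₐ[S] (AT m) :=
        { toFun := fun c => ⟨⟨τ m ((c : T₀) : F), hτT₀ m hm' _ (c : T₀).2⟩, hstab _ c.2⟩
          invFun := fun c => ⟨⟨(τ m).symm ((c : T₀) : F), hτT₀' m hm' _ (c : T₀).2⟩, hstab' _ c.2⟩
          left_inv := fun c => Subtype.ext (Subtype.ext ((τ m).symm_apply_apply ((c : T₀) : F)))
          right_inv := fun c => Subtype.ext (Subtype.ext ((τ m).apply_symm_apply ((c : T₀) : F)))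
          map_mul' := fun a b =>
            Subtype.ext (Subtype.ext (map_mul (τ m) ((a : T₀) : F) ((b : T₀) : F)))
          map_add' := fun a b =>
            Subtype.ext (Subtype.ext (map_add (τ m) ((a : T₀) : F) ((b : T₀) : F)))
          commutes' := fun s => Subtype.ext (Subtype.ext (hτS m hm' _ s.2)) }
      have hσC_apply : ∀ c : AT m, (((σC c : AT m) : T₀) : F) = τ m ((c : T₀) : F) :=
        fun c => rfl
      have hσCpow : ∀ (k : ℕ) (c : AT m), ((((σC ^ k) c : AT m) : T₀) : F) =
          (τ m ^ k) ((c : T₀) : F) := by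
        intro k
        induction k with
        | zero => intro c; rfl
        | succ k ih =>
          intro c
          rw [pow_succ', AlgEquiv.mul_apply, pow_succ', RingAut.mul_apply, hσC_apply, ih]
      have hσCℓ : σC ^ ℓ = 1 :=
        AlgEquiv.ext fun c => Subtype.ext (Subtype.ext (by rw [hσCpow, hτℓ m hm']; rfl))
      let AT' : Subalgebra S (AT m) :=
        { carrier := {c | σC c = c}
          mul_mem' := fun {a b} ha hb => by
            change σC (a * b) = a * b; rw [map_mul, (ha : σC a = a), (hb : σC b = b)]
          one_mem' := map_one σC
          add_mem' := fun {a b} ha hb => by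
            change σC (a + b) = a + b; rw [map_add, (ha : σC a = a), (hb : σC b = b)]
          zero_mem' := map_zero σC
          algebraMap_mem' := fun s => σC.commutes s }
      have hAT' : ∀ c : AT m, c ∈ AT' ↔ σC c = c := fun c => Iff.rfl
      have hfg' : AT'.FG := fg_fixedSubalgebra_of_cyclic σC hℓ0 hσCℓ AT' hAT'
      have hmap : AT (m + 1) = AT'.map (AT m).val := by
        ext c
        constructor
        · intro hc
          rw [hAT (m + 1) hm] at hc
          refine Subalgebra.mem_map.mpr
            ⟨⟨c, (hAT m hm'.le c).mpr fun i hi => hc i (Nat.lt_succ_of_lt hi)⟩, ?_, rfl⟩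
          rw [hAT']
          exact Subtype.ext (Subtype.ext (hc m (Nat.lt_succ_self m)))
        · intro hc
          obtain ⟨c', hc', rfl⟩ := Subalgebra.mem_map.mp hc
          have h1 : ∀ i < m, τ i ((c' : T₀) : F) = c' := (hAT m hm'.le _).mp c'.2
          have h2 : τ m ((c' : T₀) : F) = c' :=
            congrArg (fun z : AT m => ((z : T₀) : F)) ((hAT' c').mp hc')
          rw [hAT (m + 1) hm]
          change ∀ i < m + 1, τ i ((c' : T₀) : F) = c'
          intro i hi
          rcases Nat.lt_succ_iff_lt_or_eq.mp hi with hi | rfl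
          · exact h1 i hi
          · exact h2
      rw [hmap]
      exact hfg'.map _
  obtain ⟨g, hg⟩ := hATfg r le_rfl
  -- generators of `T₀^G` in `F`
  refine ⟨g.image (fun c : T₀ => (c : F)), ?_, ?_, ?_⟩
  · intro i hi z hz
    obtain ⟨c, hc, rfl⟩ := Finset.mem_image.mp hz
    have : c ∈ AT r := by rw [← hg]; exact Algebra.subset_adjoin hc
    exact (hAT r le_rfl c).mp this i hi
  · intro z hz
    obtain ⟨c, -, rfl⟩ := Finset.mem_image.mp hz
    exact c.2
  · apply le_antisymm
    · rintro x ⟨hx1, hx2⟩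
      have hxAT : (⟨x, hx1⟩ : T₀) ∈ AT r := (hAT r le_rfl _).mpr hx2
      rw [← hg] at hxAT
      refine Algebra.adjoin_induction (p := fun (c : T₀) _ => (c : F) ∈
          Subring.closure ((S : Set F) ∪ ↑(g.image (fun c : T₀ => (c : F))))) ?_ ?_ ?_ ?_ hxAT
      · intro c hc
        exact Subring.subset_closure (Or.inr (Finset.mem_coe.mpr
          (Finset.mem_image.mpr ⟨c, hc, rfl⟩)))
      · intro s
        exact Subring.subset_closure (Or.inl s.2)
      · intro a b _ _ ha hb
        exact Subring.add_mem _ ha hb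
      · intro a b _ _ ha hb
        exact Subring.mul_mem _ ha hb
    · refine Subring.closure_le.mpr (Set.union_subset (fun s hs => ⟨hST₀ hs, fun i hi => hτS i hi s hs⟩) ?_)
      intro z hz
      obtain ⟨c, hc, rfl⟩ := Finset.mem_image.mp (Finset.mem_coe.mp hz)
      have : c ∈ AT r := by rw [← hg]; exact Algebra.subset_adjoin hc
      exact ⟨c.2, (hAT r le_rfl c).mp this⟩

end JointFixed

end Summit.ResolutionOfSingularities.ResolutionOfSingularities.Theorems.TameAbelianQuotientLU

end
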